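import Summits.HodgeConjecture.HodgeConjecture.Theorems.NikulinTwinTransportRealMultiplicationPointwise

/-!
# Route NikulinTwinTransport · crux `TwinTransportRMPicardTwo` (stmt-HodgeConjecture-15067) —
# reach: anchors transfer along rational Hodge isometries

The conclusion of the milestone at a projective K3 surface `S` is the existence of an ANCHOR into
`S`: a projective K3 partner `S″`, a generator `p″` of `H⁴(S″)` and an algebraic `ℂ`-linear
equivalence `Ψ : H²(S″) ≃ H²(S)` whose inverse is rational, type-preserving and halves the cup
form. This notion does not mention the real multiplication, and it is an invariant of the
rational Hodge ISOMETRY class of `S`, granted Buskin's theorem and the composition of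
correspondences: if `φ : H²(S) ≃ H²(X)` is a rational Hodge isometry (both directions rational and
type-preserving, `(x.y) = a·p_S ⟹ (φx.φy) = a·p_X`) and `X` has an anchor `Ψ`, then
`φ⁻¹ ∘ Ψ` is an anchor into `S` (`φ⁻¹ = [γ₁]_*` by Buskin, composition by `hC`).

* `rmAnchor_transfer_of_hodgeIsometry` — the statement above.

Use (step (4) "REACH" of the crux idea `zeta8-double-quadric-anchor`): with the ζ₈-species
theorem `rmAnchor_of_swapAutomorphism`, the milestone's conclusion holds — modulo Buskin +
composition of correspondences + the marking fact — on the whole rational-Hodge-isometry class of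
the order-8 double quadrics (every "Hecke translate" of a point of the `ζ₈`-ball), not only on the
4-dimensional family itself. Prover seat prover-…-NikulinTwinTransport-1.
References: [Buskin2019] Thm. 1.1, Lemma 6.3; [Varesco2023] §2; [Fulton1998] §16.1 Prop. 16.1.1.
-/

noncomputable section

namespace Summit.HodgeConjecture.HodgeConjecture.Theorems.NikulinTwinTransport

open scoped Manifold
open CategoryTheory MonoidalCategory SemiCartesianMonoidalCategory
open Literature.AlgebraicGeometry.Motives Literature.AlgebraicGeometry.HodgeTheory
open Literature.AlgebraicGeometry.Surfaces Literature.Geometry.Kaehler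
open Literature.AlgebraicTopology.SingularHomology

/-- **Anchors transfer along rational Hodge isometries** (granted Buskin's theorem `hB`, the
composition `hC` of algebraic degree-`2` correspondences between smooth projective surfaces, and
the marking fact): for projective K3 surfaces `S`, `X` with integral generators `p_S`, `p_X` of
`H⁴`, a `ℂ`-linear equivalence `φ : H²(S) ≃ H²(X)` rational and type-preserving in both
directions with `(x.y) = a·p_S ⟹ (φx.φy) = a·p_X`, and an anchor `(X″, p″, Ψ)` into `X`, the
composite `φ⁻¹ ∘ Ψ : H²(X″) ≃ H²(S)` is an anchor into `S`: its inverse `Ψ⁻¹ ∘ φ` is rational,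
type-preserving and halves the cup form, and it is algebraic on `S × X″` because `φ⁻¹` is a
rational Hodge isometry `H²(X) → H²(S)` (cup products on `S` are multiples of `p_S` by the marking),
hence `[γ₁]_*` by Buskin, and `[γ₁]_* ∘ [γ]_* = [γ₂]_*` by `hC`. [cite: Buskin2019, Thm. 1.1 and
Lemma 6.3] [cite: Varesco2023, §2] -/
theorem rmAnchor_transfer_of_hodgeIsometry
    (hB : Theses.NikulinTwinTransport.HodgeIsometryAlgebraic)
    (hC : ∀ (μ : OrientationFamily), μ.HasPoincareDuality →
      ∀ (A B C : SchemeOver ℂ) (hA : IsSmoothProjective 2 A) (hB : IsSmoothProjective 2 B)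
        (hC : IsSmoothProjective 2 C),
        ∀ γ ∈ algebraicClasses (A ⊗ B) 2, ∀ γ₁ ∈ algebraicClasses (B ⊗ C) 2,
          ∃ γ₂ ∈ algebraicClasses (A ⊗ C) 2, ∀ x : complexBetti C (2 * 1),
            complexGysin μ (IsSmoothProjective.tensor_holds hA hC) hA (fst A C)
                (rfl : 2 * 1 + 2 * 2 + 2 * 2 = 2 * 1 + 2 * (2 + 2))
                (cupProduct (rfl : 2 * 1 + 2 * 2 = 2 * 1 + 2 * 2)
                  (complexBetti.map (snd A C) (2 * 1) x) γ₂) =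
              complexGysin μ (IsSmoothProjective.tensor_holds hA hB) hA (fst A B)
                (rfl : 2 * 1 + 2 * 2 + 2 * 2 = 2 * 1 + 2 * (2 + 2))
                (cupProduct (rfl : 2 * 1 + 2 * 2 = 2 * 1 + 2 * 2)
                  (complexBetti.map (snd A B) (2 * 1)
                    (complexGysin μ (IsSmoothProjective.tensor_holds hB hC) hB (fst B C)
                      (rfl : 2 * 1 + 2 * 2 + 2 * 2 = 2 * 1 + 2 * (2 + 2))
                      (cupProduct (rfl : 2 * 1 + 2 * 2 = 2 * 1 + 2 * 2)
                        (complexBetti.map (snd B C) (2 * 1) x) γ₁)))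
                  γ))
    (hmark : Huybrechts_K3_marking_exists)
    (μ : OrientationFamily) (hμ : μ.HasPoincareDuality) {S X : SchemeOver ℂ}
    (hS : IsK3Surface S) (hX : IsK3Surface X)
    (pS : complexBetti S (2 * 2)) (pX : complexBetti X (2 * 2))
    (hpS : IsIntegralClass pS ∧ ∀ q : complexBetti S (2 * 2), IsIntegralClass q → ∃ n : ℤ, q = n • pS)
    (hpX : IsIntegralClass pX ∧ ∀ q : complexBetti X (2 * 2), IsIntegralClass q → ∃ n : ℤ, q = n • pX)
    (φ : complexBetti S (2 * 1) ≃ₗ[ℂ] complexBetti X (2 * 1))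
    (hφr : ∀ x, IsRationalClass x → IsRationalClass (φ x))
    (hφr' : ∀ y, IsRationalClass y → IsRationalClass (φ.symm y))
    (hφt : ∀ (i j : ℕ) x, IsOfHodgeType 2 S (2 * 1) i j x → IsOfHodgeType 2 X (2 * 1) i j (φ x))
    (hφt' : ∀ (i j : ℕ) y, IsOfHodgeType 2 X (2 * 1) i j y → IsOfHodgeType 2 S (2 * 1) i j (φ.symm y))
    (hφi : ∀ (x y : complexBetti S (2 * 1)) (a : ℂ),
      cupProduct (rfl : 2 * 1 + 2 * 1 = 2 * 2) x y = a • pS →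
        cupProduct (rfl : 2 * 1 + 2 * 1 = 2 * 2) (φ x) (φ y) = a • pX)
    (hA : ∃ (X'' : SchemeOver ℂ) (hX'' : IsK3Surface X'') (p'' : complexBetti X'' (2 * 2)),
      (IsIntegralClass p'' ∧
        ∀ q : complexBetti X'' (2 * 2), IsIntegralClass q → ∃ n : ℤ, q = n • p'') ∧
      ∃ Ψ : complexBetti X'' (2 * 1) ≃ₗ[ℂ] complexBetti X (2 * 1),
        (∀ y, IsRationalClass y → IsRationalClass (Ψ.symm y)) ∧
        (∀ (i j : ℕ) y, IsOfHodgeType 2 X (2 * 1) i j y →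
          IsOfHodgeType 2 X'' (2 * 1) i j (Ψ.symm y)) ∧
        (∀ (u v : complexBetti X (2 * 1)) (b : ℂ),
          cupProduct (rfl : 2 * 1 + 2 * 1 = 2 * 2) u v = ((2 : ℂ) * b) • pX →
            cupProduct (rfl : 2 * 1 + 2 * 1 = 2 * 2) (Ψ.symm u) (Ψ.symm v) = b • p'') ∧
        ∃ γ ∈ algebraicClasses (X ⊗ X'') 2, ∀ x : complexBetti X'' (2 * 1),
          Ψ x = complexGysin μ (IsSmoothProjective.tensor_holds hX.1 hX''.1) hX.1 (fst X X'')
            (rfl : 2 * 1 + 2 * 2 + 2 * 2 = 2 * 1 + 2 * (2 + 2))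
            (cupProduct (rfl : 2 * 1 + 2 * 2 = 2 * 1 + 2 * 2)
              (complexBetti.map (snd X X'') (2 * 1) x) γ)) :
    ∃ (S'' : SchemeOver ℂ) (hS'' : IsK3Surface S'') (p'' : complexBetti S'' (2 * 2)),
      (IsIntegralClass p'' ∧
        ∀ q : complexBetti S'' (2 * 2), IsIntegralClass q → ∃ n : ℤ, q = n • p'') ∧
      ∃ Ψ : complexBetti S'' (2 * 1) ≃ₗ[ℂ] complexBetti S (2 * 1),
        (∀ y, IsRationalClass y → IsRationalClass (Ψ.symm y)) ∧
        (∀ (i j : ℕ) y, IsOfHodgeType 2 S (2 * 1) i j y →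
          IsOfHodgeType 2 S'' (2 * 1) i j (Ψ.symm y)) ∧
        (∀ (u v : complexBetti S (2 * 1)) (b : ℂ),
          cupProduct (rfl : 2 * 1 + 2 * 1 = 2 * 2) u v = ((2 : ℂ) * b) • pS →
            cupProduct (rfl : 2 * 1 + 2 * 1 = 2 * 2) (Ψ.symm u) (Ψ.symm v) = b • p'') ∧
        ∃ γ ∈ algebraicClasses (S ⊗ S'') 2, ∀ x : complexBetti S'' (2 * 1),
          Ψ x = complexGysin μ (IsSmoothProjective.tensor_holds hS.1 hS''.1) hS.1 (fst S S'')
            (rfl : 2 * 1 + 2 * 2 + 2 * 2 = 2 * 1 + 2 * (2 + 2))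
            (cupProduct (rfl : 2 * 1 + 2 * 2 = 2 * 1 + 2 * 2)
              (complexBetti.map (snd S S'') (2 * 1) x) γ) := by
  obtain ⟨X'', hX'', p'', hp'', Ψ, hΨr, hΨt, hΨc, γ, hγ, hΨγ⟩ := hA
  -- cup products on `S` are multiples of `p_S` (marking), so `φ⁻¹` is an isometry `(X, p_X) → (S, p_S)`
  obtain ⟨η, p₀, x₀, hp₀, ⟨hp₀int, hp₀gen, -, hηcup, -, -⟩, -⟩ := hmark S hS
  have hpS0 : pS ≠ 0 := generator_ne_zero hS hpS.2
  have hpX0 : pX ≠ 0 := generator_ne_zero hX hpX.2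
  have hp₀S : p₀ = pS ∨ p₀ = -pS := eq_or_eq_neg_of_zsmul hpS0 (hp₀gen pS hpS.1) (hpS.2 p₀ hp₀int)
  have hmul : ∀ x y : complexBetti S (2 * 1), ∃ c : ℂ,
      cupProduct (rfl : 2 * 1 + 2 * 1 = 2 * 2) x y = c • pS := fun x y => by
    rcases hp₀S with h | h
    · exact ⟨k3Form (η x) (η y), by rw [hηcup, h]⟩
    · exact ⟨-k3Form (η x) (η y), by rw [hηcup, h, smul_neg, neg_smul]⟩
  have hφi' : ∀ (y y' : complexBetti X (2 * 1)) (a : ℂ),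
      cupProduct (rfl : 2 * 1 + 2 * 1 = 2 * 2) y y' = a • pX →
        cupProduct (rfl : 2 * 1 + 2 * 1 = 2 * 2) (φ.symm y) (φ.symm y') = a • pS := by
    intro y y' a hyy
    obtain ⟨c, hc⟩ := hmul (φ.symm y) (φ.symm y')
    have h := hφi _ _ c hc
    rw [LinearEquiv.apply_symm_apply, LinearEquiv.apply_symm_apply, hyy] at h
    rw [hc, smul_left_injective ℂ hpX0 h]
  -- Buskin: `φ⁻¹ = [γ₁]_*` on `S × X`
  obtain ⟨γ₁, hγ₁, hφγ₁⟩ := hB μ hμ S X hS hX pS pX hpS hpX φ.symm.toLinearMap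
    (fun y hy => hφr' y hy) (fun i j y hy => hφt' i j y hy) (fun y y' a h => hφi' y y' a h)
  -- composition: `φ⁻¹ ∘ Ψ = [γ₂]_*` on `S × X″`
  obtain ⟨γ₂, hγ₂, hcomp⟩ := hC μ hμ S X X'' hS.1 hX.1 hX''.1 γ₁ hγ₁ γ hγ
  refine ⟨X'', hX'', p'', hp'', Ψ.trans φ.symm, fun y hy => ?_, fun i j y hy => ?_,
    fun u v b huv => ?_, γ₂, hγ₂, fun x => ?_⟩
  · rw [LinearEquiv.symm_trans_apply, LinearEquiv.symm_symm]
    exact hΨr _ (hφr y hy)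
  · rw [LinearEquiv.symm_trans_apply, LinearEquiv.symm_symm]
    exact hΨt i j _ (hφt i j y hy)
  · rw [LinearEquiv.symm_trans_apply, LinearEquiv.symm_trans_apply, LinearEquiv.symm_symm]
    exact hΨc _ _ b (hφi u v _ huv)
  · rw [LinearEquiv.trans_apply, hcomp x, ← hΨγ x]
    exact hφγ₁ (Ψ x)

end Summit.HodgeConjecture.HodgeConjecture.Theorems.NikulinTwinTransport

end
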